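import Mathlib.Analysis.SpecialFunctions.Pow.Real
import Mathlib.Analysis.SpecialFunctions.Pow.Continuity
import Mathlib.Topology.MetricSpace.Basic

/-!
# Exponent bookkeeping of the transfer `C⁺`

Helper file for the crux `QuadrupoleSelectionRule` (stmt-CriticalPhenomena-7029), route
`CardyFlipRusso`, sub-problem `CardyFormulaZ2`, line `Sketch` generation 2 ("TransferR2"),
stub T5 "exponent bookkeeping of the transfer `C⁺`".

With matching scale `r = δ ^ a` (`0 ≤ a ≤ 1`), inner rate `θ_in`, outer rate `θ_out` and
marginality exponent `θ⋆` of the flip-weighted pivotal count `N`, i.e.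
`0 ≤ N δ ≤ C' δ ^ (-(θ⋆ + ε))` on `0 < δ < 1`, a bound of the annealed flip sum of the form
`|S δ| ≤ C (δ / δ ^ a) ^ θ_in (δ ^ a) ^ θ_out N δ` on `0 < δ < 1` together with the exponent gap
`(1 - a) θ_in + a θ_out > θ⋆ + ε` forces `S δ → 0` as `δ → 0⁺`.

Indeed, for `0 < δ` one has `δ / δ ^ a = δ ^ (1 - a)`, so collecting real powers gives
`|S δ| ≤ C C' δ ^ κ` with `κ = (1 - a) θ_in + a θ_out - (θ⋆ + ε) > 0`, and `δ ^ κ → 0` as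
`δ → 0⁺`.

All statements are elementary real analysis (`Real.rpow` algebra and a squeeze argument);
all powers are real powers `Real.rpow`.
-/

noncomputable section

open Filter Topology

namespace Summit.CriticalPhenomena.CardyFormulaZ2.Theorems

/-- `δ ↦ δ ^ κ → 0` as `δ → 0⁺`, for a real exponent `κ > 0`. [folklore] -/
theorem tendsto_rpow_nhdsGT_zero_of_pos {κ : ℝ} (hκ : 0 < κ) :
    Tendsto (fun δ : ℝ => δ ^ κ) (𝓝[>] 0) (𝓝 0) := by
  have h : Tendsto (fun δ : ℝ => δ ^ κ) (𝓝 0) (𝓝 ((0 : ℝ) ^ κ)) :=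
    (Real.continuousAt_rpow_const 0 κ (Or.inr hκ.le)).tendsto
  rw [Real.zero_rpow hκ.ne'] at h
  exact tendsto_nhdsWithin_of_tendsto_nhds h

/-- Exponent collection: for `0 < δ` and real `a, θ_in, θ_out, t`,
`(δ / δ ^ a) ^ θ_in * (δ ^ a) ^ θ_out * δ ^ (-t) = δ ^ ((1 - a) θ_in + a θ_out - t)`.
[folklore] -/
theorem div_rpow_rpow_mul_rpow_rpow_mul_rpow_neg {δ : ℝ} (hδ : 0 < δ) (a θin θout t : ℝ) :
    (δ / δ ^ a) ^ θin * (δ ^ a) ^ θout * δ ^ (-t) = δ ^ ((1 - a) * θin + a * θout - t) := by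
  have h1 : δ / δ ^ a = δ ^ (1 - a) := by rw [Real.rpow_sub hδ, Real.rpow_one]
  rw [h1, ← Real.rpow_mul hδ.le, ← Real.rpow_mul hδ.le, ← Real.rpow_add hδ, ← Real.rpow_add hδ,
    sub_eq_add_neg ((1 - a) * θin + a * θout) t]

/-- Pointwise form of the exponent bookkeeping: on `0 < δ`, a bound
`|s| ≤ C (δ / δ ^ a) ^ θ_in (δ ^ a) ^ θ_out n` with `C ≥ 0` and `n ≤ C' δ ^ (-(θ⋆ + ε))` gives
`|s| ≤ C C' δ ^ ((1 - a) θ_in + a θ_out - (θ⋆ + ε))`. [folklore] -/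
theorem abs_le_mul_rpow_of_exponent_bookkeeping {δ s n C C' θin θout θstar ε a : ℝ}
    (hδ : 0 < δ) (hC : 0 ≤ C) (hn : n ≤ C' * δ ^ (-(θstar + ε)))
    (hs : |s| ≤ C * (δ / δ ^ a) ^ θin * (δ ^ a) ^ θout * n) :
    |s| ≤ C * C' * δ ^ ((1 - a) * θin + a * θout - (θstar + ε)) := by
  have hP : 0 ≤ C * (δ / δ ^ a) ^ θin * (δ ^ a) ^ θout :=
    mul_nonneg (mul_nonneg hC (Real.rpow_nonneg (div_nonneg hδ.le (Real.rpow_nonneg hδ.le a)) _))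
      (Real.rpow_nonneg (Real.rpow_nonneg hδ.le a) _)
  calc |s| ≤ C * (δ / δ ^ a) ^ θin * (δ ^ a) ^ θout * n := hs
    _ ≤ C * (δ / δ ^ a) ^ θin * (δ ^ a) ^ θout * (C' * δ ^ (-(θstar + ε))) :=
        mul_le_mul_of_nonneg_left hn hP
    _ = C * C' * ((δ / δ ^ a) ^ θin * (δ ^ a) ^ θout * δ ^ (-(θstar + ε))) := by ring
    _ = C * C' * δ ^ ((1 - a) * θin + a * θout - (θstar + ε)) := by
        rw [div_rpow_rpow_mul_rpow_rpow_mul_rpow_neg hδ a θin θout (θstar + ε)]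

/-- **Exponent bookkeeping of the transfer `C⁺`** (stub T5 of line `Sketch`, generation 2, for
the crux `QuadrupoleSelectionRule`).  With matching scale `r = δ ^ a`, inner rate `θ_in`, outer
rate `θ_out` and marginality exponent `θ⋆` of the flip-weighted pivotal count `N`
(`0 ≤ N δ ≤ C' δ ^ (-(θ⋆ + ε))` on `0 < δ < 1`), a bound
`|S δ| ≤ C (δ / δ ^ a) ^ θ_in (δ ^ a) ^ θ_out N δ` on `0 < δ < 1` and the exponent gap
`θ⋆ + ε < (1 - a) θ_in + a θ_out` force the annealed flip sum `S δ → 0` as `δ → 0⁺`.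
(The hypotheses `0 ≤ a ≤ 1`, `0 ≤ C'` and `0 ≤ N` are part of the bookkeeping set-up but are not
needed for the conclusion.) [folklore] -/
theorem tendsto_zero_of_exponent_gap (S N : ℝ → ℝ) (C C' θin θout θstar ε a : ℝ) (_ha0 : 0 ≤ a)
    (_ha1 : a ≤ 1) (hC : 0 ≤ C) (_hC' : 0 ≤ C') (hgap : θstar + ε < (1 - a) * θin + a * θout)
    (_hN0 : ∀ δ, 0 < δ → δ < 1 → 0 ≤ N δ)
    (hN : ∀ δ, 0 < δ → δ < 1 → N δ ≤ C' * δ ^ (-(θstar + ε)))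
    (hS : ∀ δ, 0 < δ → δ < 1 → |S δ| ≤ C * (δ / δ ^ a) ^ θin * (δ ^ a) ^ θout * N δ) :
    Tendsto S (𝓝[>] 0) (𝓝 0) := by
  have hκ : 0 < (1 - a) * θin + a * θout - (θstar + ε) := sub_pos.mpr hgap
  -- Eventual bound `‖S δ‖ ≤ C C' δ ^ κ` on the right neighbourhood of `0` (restricted to `δ < 1`).
  have hev : ∀ᶠ δ in 𝓝[>] (0 : ℝ),
      ‖S δ‖ ≤ C * C' * δ ^ ((1 - a) * θin + a * θout - (θstar + ε)) := by
    filter_upwards [Ioo_mem_nhdsGT (zero_lt_one' ℝ)] with δ hδ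
    rw [Real.norm_eq_abs]
    exact abs_le_mul_rpow_of_exponent_bookkeeping hδ.1 hC (hN δ hδ.1 hδ.2) (hS δ hδ.1 hδ.2)
  -- The majorant `C C' δ ^ κ` tends to `0` as `δ → 0⁺` since `κ > 0`.
  have hmaj : Tendsto (fun δ : ℝ => C * C' * δ ^ ((1 - a) * θin + a * θout - (θstar + ε)))
      (𝓝[>] 0) (𝓝 0) := by
    simpa only [mul_zero] using (tendsto_rpow_nhdsGT_zero_of_pos hκ).const_mul (C * C')
  exact squeeze_zero_norm' hev hmaj

end Summit.CriticalPhenomena.CardyFormulaZ2.Theorems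

end
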